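import Literature.Probability.Percolation.TriSandpileOneBlock
import Literature.Probability.Percolation.TriLatticeFill
import HarnessLib

/-!
# The sandpile class, II: connectivity, co-connectivity, and the discrete domain («SANDPILE-DOMAIN»)

Topic `Literature/Probability/Percolation`; family `crit-perc` / marked-loop lineage; a rider on `TriSandpileOneBlock.lean` («SANDPILE-ONEBLOCK»: `baseStrip`, `IsPile`, `sandpile`, the
support calculus, ★★★ `oneBlockAt_sandpile`) and `TriOneBlock.lean` (`TriMarkedDomain.ofOneBlock`). Second half of (G0a) of HOME `pub-sawmu-b-engine-2/gen23/DESIGN-next-gen23.md`: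

* straight segments are paths — the tree's `pathIn_straight` (`TriLatticeFill.lean`; ed.1 restated it as `pathIn_steps` and was bounced `dedup.landed`, ed.1b imports it);
* `pile_bounds` — a pile cell `c` has `0 ≤ c₀ + c₁` and `c₀ < L` (its two chains of supporters reach the base); hence the HIGHWAYS: the column `x = −1`, the columns `x ≥ L`, the rows
  `y ≥ 2` and the rows `y ≤ −L` contain no site of the sandpile (`not_mem_of_fst_neg`, `not_mem_of_le_fst`, `not_mem_of_two_le`, `not_mem_of_le_neg`);
* ★ `pathIn_sandpile` — the sandpile is connected (pile cells climb along `e₁` to the base; the base is a two-row strip);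
* ★ `pathIn_compl_sandpile` — its complement is connected (outer sites below descend along `e₄` — nothing hangs from an outer site — to the free rows, outer sites above or
  beside use the free rows/columns; everything meets at `(−1, 0)`);
* ★★★ `TriMarkedDomain.ofSandpile` — **every sandpile (`L ≥ 2`, `P` a pile) is an unmarked discrete domain** (`ofOneBlock` with «SANDPILE-ONEBLOCK»); `ofSandpile_verts`.

Marks (car «TRI-MARK-DARTS» / «RING-LOCAL»), boundary mid-edges («ARC-POINT-OF-DART» / «RING-LOCAL») and arcs («STRETCH-OF-DARTS») then make the lawpoints of the tame family.

## References
* B. Bollobás, O. Riordan, *Percolation*, Cambridge University Press (2006), Ch. 7 §7.2.2 p. 168 (discrete domains).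

## Mathlib / tree
Tree: `TriSandpileOneBlock` (all of it), `TriOneBlock` (`TriMarkedDomain.ofOneBlock`, `ofOneBlock_verts`), `TriLatticeFill` (`pathIn_straight`), `SitePaths` (`PathIn`, `refl`, `tail`, `trans`, `symm`, `mono`), `TriDiscShelling`
(`triDir`, `triGraph_adj_add_triDir`). Mathlib: `add_smul`, `one_smul`, `omega`.
-/

noncomputable section

open Finset Literature.Probability.LatticeModels

namespace Literature.Probability.Percolation

namespace Sandpile

/-! ### Straight segments -/

/-- coordinates along a segment. [cite: BollobasRiordan2006, Ch. 7 §7.2.2 p. 168; lane plumbing] -/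
theorem add_smul_triDir_apply (x : Site 2) (t : ℤ) (j : Fin 6) (i : Fin 2) : (x + t • triDir j) i = x i + t * triDir j i := by
  simp

/-! ### Where the sandpile is, and where it is not -/

variable {L : ℕ} {P : Finset (Site 2)} (hP : IsPile L P)
include hP

/-- **a pile cell lies in the shadow of the base**: `0 ≤ c₀ + c₁` and `c₀ < L` (follow the left supporters `e₂` and the right supporters `e₁` up to the base).
[cite: BollobasRiordan2006, Ch. 7 §7.2.2 p. 168; lane plumbing] -/
theorem pile_bounds : ∀ (n : ℕ) (c : Site 2), c ∈ P → c 1 = -(n : ℤ) → 0 ≤ c 0 + c 1 ∧ c 0 < L := by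
  have T := triDir_apply
  intro n
  induction n using Nat.strong_induction_on with
  | _ n ih =>
    intro c hc hn
    have hneg := hP.below c hc
    have h1 := hP.sup₁ c hc
    have h2 := hP.sup₂ c hc
    rw [← sandpile.eq_1] at h1 h2
    by_cases hn1 : n = 1
    · -- the supporters are base cells
      subst hn1
      have hy1 : 0 ≤ (c + triDir 1) 1 := by simp [T]; omega
      have hy2 : 0 ≤ (c + triDir 2) 1 := by simp [T]; omega
      rw [mem_sandpile] at h1 h2
      rcases h1 with h1 | h1
      · rcases h2 with h2 | h2
        · rw [mem_baseStrip] at h1 h2; simp [T] at h1 h2; omega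
        · exact absurd h2 (not_mem_pile_of_nonneg hP hy2)
      · exact absurd h1 (not_mem_pile_of_nonneg hP hy1)
    · -- the supporters are pile cells one level up
      have hn2 : 2 ≤ n := by omega
      have hy1 : (c + triDir 1) 1 < 0 := by simp [T]; omega
      have hy2 : (c + triDir 2) 1 < 0 := by simp [T]; omega
      have hp1 : c + triDir 1 ∈ P := (mem_sandpile_of_neg hy1).1 h1
      have hp2 : c + triDir 2 ∈ P := (mem_sandpile_of_neg hy2).1 h2
      have e1 : (c + triDir 1) 1 = -((n - 1 : ℕ) : ℤ) := by simp [T]; omega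
      have e2 : (c + triDir 2) 1 = -((n - 1 : ℕ) : ℤ) := by simp [T]; omega
      have r1 := ih (n - 1) (by omega) _ hp1 e1
      have r2 := ih (n - 1) (by omega) _ hp2 e2
      simp [T] at r1 r2
      omega

/-- the shadow, without the height parameter. [cite: BollobasRiordan2006, Ch. 7 §7.2.2 p. 168; lane plumbing] -/
theorem pile_bounds' {c : Site 2} (hc : c ∈ P) : 0 ≤ c 0 + c 1 ∧ c 0 < L := by
  have hneg := hP.below c hc
  exact pile_bounds hP (-(c 1)).toNat c hc (by omega)

/-- **the columns `x < 0` are free.** [cite: BollobasRiordan2006, Ch. 7 §7.2.2 p. 168; lane plumbing] -/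
theorem not_mem_of_fst_neg {x : Site 2} (hx : x 0 < 0) : x ∉ sandpile L P := by
  rw [mem_sandpile, mem_baseStrip]
  rintro (hb | hp)
  · omega
  · have := pile_bounds' hP hp; have := hP.below x hp; omega

/-- **the columns `x ≥ L` are free.** [cite: BollobasRiordan2006, Ch. 7 §7.2.2 p. 168; lane plumbing] -/
theorem not_mem_of_le_fst {x : Site 2} (hx : (L : ℤ) ≤ x 0) : x ∉ sandpile L P := by
  rw [mem_sandpile, mem_baseStrip]
  rintro (hb | hp)
  · omega
  · have := pile_bounds' hP hp; omega

/-- **the rows `y ≥ 2` are free.** [cite: BollobasRiordan2006, Ch. 7 §7.2.2 p. 168; lane plumbing] -/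
theorem not_mem_of_two_le {x : Site 2} (hx : 2 ≤ x 1) : x ∉ sandpile L P := by
  rw [mem_sandpile, mem_baseStrip]
  rintro (hb | hp)
  · omega
  · have := hP.below x hp; omega

/-- **the rows `y ≤ −L` are free.** [cite: BollobasRiordan2006, Ch. 7 §7.2.2 p. 168; lane plumbing] -/
theorem not_mem_of_le_neg {x : Site 2} (hx : x 1 ≤ -(L : ℤ)) : x ∉ sandpile L P := by
  rw [mem_sandpile, mem_baseStrip]
  rintro (hb | hp)
  · omega
  · have := pile_bounds' hP hp; omega

/-- **nothing hangs below an outer site**: the downward ray from a site outside the sandpile at height `≤ 0` stays outside. [cite: BollobasRiordan2006, Ch. 7 §7.2.2 p. 168; lane plumbing] -/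
theorem add_smul_four_not_mem {x : Site 2} (hx1 : x 1 ≤ 0) (hx : x ∉ sandpile L P) (t : ℕ) : x + (t : ℤ) • triDir 4 ∉ sandpile L P := by
  have T := triDir_apply
  induction t with
  | zero => simpa using hx
  | succ t ih =>
    intro h
    apply ih
    have e : x + ((t + 1 : ℕ) : ℤ) • triDir 4 = (x + (t : ℤ) • triDir 4) + triDir 4 := by
      push_cast; rw [add_smul, one_smul, add_assoc]
    rw [e] at h
    exact mem_of_add_four_mem hP (by simp [T]; omega) h

/-- **the upward chain of supporters**: from a pile cell the sites `c + t e₁`, `t ≤ −c₁`, are in the sandpile. [cite: BollobasRiordan2006, Ch. 7 §7.2.2 p. 168; lane plumbing] -/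
theorem add_smul_one_mem {c : Site 2} (hc : c ∈ sandpile L P) (t : ℕ) (ht : (t : ℤ) ≤ -(c 1)) : c + (t : ℤ) • triDir 1 ∈ sandpile L P := by
  have T := triDir_apply
  induction t with
  | zero => simpa using hc
  | succ t ih =>
    have ih' := ih (by push_cast at ht; omega)
    have hy : (c + (t : ℤ) • triDir 1) 1 < 0 := by simp [T]; push_cast at ht; omega
    have hp : c + (t : ℤ) • triDir 1 ∈ P := (mem_sandpile_of_neg hy).1 ih'
    have := hP.sup₁ _ hp
    rw [← sandpile.eq_1] at this
    have e : c + ((t + 1 : ℕ) : ℤ) • triDir 1 = (c + (t : ℤ) • triDir 1) + triDir 1 := by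
      push_cast; rw [add_smul, one_smul, add_assoc]
    rw [e]; exact this

/-! ### Connectivity -/

omit hP in
/-- **the base strip is connected through the cell `(0, 0)`.** [cite: BollobasRiordan2006, Ch. 7 §7.2.2 p. 168; lane plumbing] -/
theorem pathIn_base_to_origin {b : Site 2} (hb : b ∈ baseStrip L) : PathIn triGraph (↑(sandpile L P) : Set (Site 2)) b ![0, 0] := by
  have T := triDir_apply
  rw [mem_baseStrip] at hb
  obtain ⟨h0, hL, h1, h2⟩ := hb
  -- first step down to row 0 (if on row 1), then left along row 0
  have hrow : ∀ (a : Site 2), 0 ≤ a 0 → a 0 < L → a 1 = 0 → PathIn triGraph (↑(sandpile L P) : Set (Site 2)) a ![0, 0] := by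
    intro a ha0 haL ha1
    have h := pathIn_straight (A := (↑(sandpile L P) : Set (Site 2))) a 3 (a 0).toNat (fun t ht => by
      rw [Finset.mem_coe, mem_sandpile, mem_baseStrip]; left; simp [T]; omega)
    have e : a + ((a 0).toNat : ℤ) • triDir 3 = ![0, 0] := by
      ext i; fin_cases i <;> simp [T] <;> omega
    rwa [e] at h
  by_cases hb1 : b 1 = 0
  · exact hrow b h0 hL hb1
  · have hb1' : b 1 = 1 := by omega
    have hdown : b + triDir 4 ∈ sandpile L P := by
      rw [mem_sandpile, mem_baseStrip]; left; simp [T]; omega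
    have hbm : b ∈ sandpile L P := by rw [mem_sandpile, mem_baseStrip]; left; omega
    exact (PathIn.of_adj (Finset.mem_coe.2 hbm) (Finset.mem_coe.2 hdown) (triGraph_adj_add_triDir b 4)).trans
      (hrow _ (by simp [T]; omega) (by simp [T]; omega) (by simp [T]; omega))

/-- ★ **THE SANDPILE IS CONNECTED.** [cite: BollobasRiordan2006, Ch. 7 §7.2.2 p. 168] -/
theorem pathIn_sandpile (p : Site 2) (hp : p ∈ sandpile L P) (q : Site 2) (hq : q ∈ sandpile L P) :
    PathIn triGraph (↑(sandpile L P) : Set (Site 2)) p q := by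
  have T := triDir_apply
  -- every site is joined to the origin
  have key : ∀ c ∈ sandpile L P, PathIn triGraph (↑(sandpile L P) : Set (Site 2)) c ![0, 0] := by
    intro c hc
    by_cases hc1 : 0 ≤ c 1
    · have hb : c ∈ baseStrip L := by
        rw [mem_sandpile] at hc
        exact hc.resolve_right (not_mem_pile_of_nonneg hP hc1)
      exact pathIn_base_to_origin hb
    · -- climb to the base
      have hneg : c 1 < 0 := by omega
      set n := (-(c 1)).toNat with hn
      have hup := pathIn_straight (A := (↑(sandpile L P) : Set (Site 2))) c 1 n (fun t ht => Finset.mem_coe.2 (add_smul_one_mem hP hc t (by omega)))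
      have htop : c + (n : ℤ) • triDir 1 ∈ baseStrip L := by
        have hm := add_smul_one_mem hP hc n (by omega)
        rw [mem_sandpile] at hm
        exact hm.resolve_right (not_mem_pile_of_nonneg hP (by simp [T]; omega))
      exact hup.trans (pathIn_base_to_origin htop)
  exact (key p hp).trans (key q hq).symm

/-! ### Co-connectivity -/

/-- ★ **THE COMPLEMENT OF THE SANDPILE IS CONNECTED** (through the free site `(−1, 0)`): outer sites below descend (nothing hangs from them) to the free rows `y ≤ −L`, outer sites above
or beside move along the free rows `y ≥ 2` / columns `x < 0`, `x ≥ L`. [cite: BollobasRiordan2006, Ch. 7 §7.2.2 p. 168] -/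
theorem pathIn_compl_sandpile (o : Site 2) (ho : o ∉ sandpile L P) (o' : Site 2) (ho' : o' ∉ sandpile L P) :
    PathIn triGraph ((↑(sandpile L P) : Set (Site 2))ᶜ) o o' := by
  have T := triDir_apply
  set S : Set (Site 2) := (↑(sandpile L P) : Set (Site 2))ᶜ with hS
  have memS : ∀ {z : Site 2}, z ∉ sandpile L P → z ∈ S := fun hz => by rw [hS, Set.mem_compl_iff, Finset.mem_coe]; exact hz
  -- (1) the column `x = -1` joins `(-1, y)` to `(-1, 0)`
  have col : ∀ z : Site 2, z 0 = -1 → PathIn triGraph S z ![-1, 0] := by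
    intro z hz
    rcases le_or_gt 0 (z 1) with hz1 | hz1
    · have h := pathIn_straight (A := S) z 4 (z 1).toNat (fun t _ => memS (not_mem_of_fst_neg hP (by simp [T]; omega)))
      have e : z + ((z 1).toNat : ℤ) • triDir 4 = ![-1, 0] := by ext i; fin_cases i <;> simp [T] <;> omega
      rwa [e] at h
    · have h := pathIn_straight (A := S) z 1 (-(z 1)).toNat (fun t _ => memS (not_mem_of_fst_neg hP (by simp [T]; omega)))
      have e : z + ((-(z 1)).toNat : ℤ) • triDir 1 = ![-1, 0] := by ext i; fin_cases i <;> simp [T] <;> omega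
      rwa [e] at h
  -- (2) a free row joins `z` horizontally to the column `x = -1`
  have row : ∀ z : Site 2, (∀ w : Site 2, w 1 = z 1 → w ∉ sandpile L P) → PathIn triGraph S z ![-1, z 1] := by
    intro z hfree
    rcases le_or_gt (-1) (z 0) with hz0 | hz0
    · have h := pathIn_straight (A := S) z 3 (z 0 + 1).toNat (fun t _ => memS (hfree _ (by simp [T])))
      have e : z + ((z 0 + 1).toNat : ℤ) • triDir 3 = ![-1, z 1] := by ext i; fin_cases i <;> simp [T]; omega
      rwa [e] at h
    · have h := pathIn_straight (A := S) z 0 (-(z 0) - 1).toNat (fun t _ => memS (hfree _ (by simp [T])))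
      have e : z + ((-(z 0) - 1).toNat : ℤ) • triDir 0 = ![-1, z 1] := by ext i; fin_cases i <;> simp [T]; omega
      rwa [e] at h
  -- (3) every outer site reaches `(-1, 0)`
  have key : ∀ z : Site 2, z ∉ sandpile L P → PathIn triGraph S z ![-1, 0] := by
    intro z hz
    rcases lt_or_ge (z 1) 0 with hneg | hnn
    · -- below: descend to the free row `y = -L - ...`, then along it, then up the column
      set d := (z 1 + L).toNat with hd
      have hdown := pathIn_straight (A := S) z 4 d (fun t _ => memS (add_smul_four_not_mem hP hneg.le hz t))
      set z' := z + (d : ℤ) • triDir 4 with hz'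
      have hz'1 : z' 1 ≤ -(L : ℤ) := by simp [hz', T]; omega
      have hrow := row z' (fun w hw => not_mem_of_le_neg hP (by omega))
      have hcol := col ![-1, z' 1] (by simp)
      exact hdown.trans (hrow.trans hcol)
    · rcases lt_or_ge (z 1) 2 with hlt2 | hge2
      · -- beside the base at height 0 or 1
        have hz0 : z 0 < 0 ∨ (L : ℤ) ≤ z 0 := by
          by_contra hcon
          push Not at hcon
          exact hz (by rw [mem_sandpile, mem_baseStrip]; left; omega)
        rcases hz0 with hl | hr
        · -- left: along the row (all of `x < 0` is free) to `x = -1`, then the column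
          have h := pathIn_straight (A := S) z 0 (-(z 0) - 1).toNat (fun t _ => memS (not_mem_of_fst_neg hP (by simp [T]; omega)))
          have e : z + ((-(z 0) - 1).toNat : ℤ) • triDir 0 = ![-1, z 1] := by ext i; fin_cases i <;> simp [T]; omega
          rw [e] at h
          exact h.trans (col _ (by simp))
        · -- right: up the free column `x ≥ L` to height 2, then the free row, then the column
          have hup := pathIn_straight (A := S) z 1 (2 - z 1).toNat (fun t _ => memS (not_mem_of_le_fst hP (by simp [T]; omega)))
          set z' := z + ((2 - z 1).toNat : ℤ) • triDir 1 with hz'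
          have hz'1 : z' 1 = 2 := by simp [hz', T]; omega
          have hrow := row z' (fun w hw => not_mem_of_two_le hP (by omega))
          exact hup.trans (hrow.trans (col _ (by simp)))
      · -- above: the free row, then the column
        exact (row z (fun w hw => not_mem_of_two_le hP (by omega))).trans (col _ (by simp))
  exact (key o ho).trans (key o' ho').symm

/-! ### The discrete domain -/

/-- ★★★ **EVERY SANDPILE IS AN UNMARKED DISCRETE DOMAIN** (`L ≥ 2`): connected, its complement connected, one-block ring patterns everywhere ⇒ `TriMarkedDomain.ofOneBlock`.
[cite: BollobasRiordan2006, Ch. 7 §7.2.2 p. 168] -/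
def _root_.Literature.Probability.Percolation.TriMarkedDomain.ofSandpile (hL : 2 ≤ L) : TriMarkedDomain 0 :=
  TriMarkedDomain.ofOneBlock (sandpile L P)
    ⟨![0, 0], by rw [mem_sandpile, mem_baseStrip]; left; simp; omega⟩
    (pathIn_sandpile hP)
    (fun o ho o' ho' => by
      have h := pathIn_compl_sandpile hP o (fun h => ho (Finset.mem_coe.2 h)) o' (fun h => ho' (Finset.mem_coe.2 h))
      exact h)
    (fun x _ => oneBlockAt_sandpile hP hL x)

/-- its site set. [cite: BollobasRiordan2006, Ch. 7 §7.2.2 p. 168; lane plumbing] -/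
@[simp] theorem ofSandpile_verts (hL : 2 ≤ L) : (TriMarkedDomain.ofSandpile hP hL).verts = sandpile L P := rfl

end Sandpile

end Literature.Probability.Percolation
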